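import Summits.ResolutionOfSingularities.ResolutionOfSingularities.Theorems.WeightedInvariantWeightedConstructionFatPointChart
import Literature.AlgebraicGeometry.Resolution.PointBlowupHsFunMono

/-!
# Fat points: the singular locus of `(𝔸ⁿ, 𝔪₀²)` is the origin

[OURS · L1 W4.3 · chain w43, stub worker 4] Chart facts for the hull-escape family of line
`pointwise-lexmax-hull`, crux `WeightedConstruction` (stmt-ResolutionOfSingularities-0571).
NOT a statement of any manuscript.

On `Y = Spec k[x₁,…,xₙ]` with `X` the ideal sheaf of `𝔪₀²` (`𝔪₀ = ker (constant coefficient)`):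
* `mem_support_fatPoint_iff`: the support of `X` is the origin;
* `not_isRegularLocalRing_quotient_maximalIdeal_sq`: a local ring `L` with some `v ∈ 𝔪_L ∖ 𝔪_L²` has
  `L ⧸ 𝔪_L²` NOT regular (its Krull dimension is `0` but its maximal ideal is not `⊥`);
* `xSing_fatPoint_iff` (`1 ≤ n`): a point is singular for `X` (in the sense of the line's `XSing`)
  iff it is the origin — the local ring of `X.subscheme` there is `𝒪_{Y,0}/𝔪₀²𝒪_{Y,0}`
  (`isRegularLocalRing_stalk_subscheme_iff`, `stalkIdeal_eq_map_germ`).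
-/

noncomputable section

open CategoryTheory AlgebraicGeometry
open Literature.AlgebraicGeometry.Resolution

set_option linter.dupNamespace false -- mandated namespace of this single-conjunct summit

namespace Summit.ResolutionOfSingularities.ResolutionOfSingularities.Theorems.PointwiseLexmaxHull

/-- **A square-zero thickening of a point is not regular.** If a local ring `L` has an element of its
maximal ideal outside the square, then `L ⧸ 𝔪_L²` is not a regular local ring: every prime of the
quotient is the maximal ideal (Krull dimension `0`), while the maximal ideal is non-zero.
[OURS · folklore] -/
theorem not_isRegularLocalRing_quotient_maximalIdeal_sq {L : Type} [CommRing L] [IsLocalRing L]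
    {v : L} (hv : v ∈ IsLocalRing.maximalIdeal L) (hv2 : v ∉ IsLocalRing.maximalIdeal L ^ 2) :
    ¬ IsRegularLocalRing (L ⧸ IsLocalRing.maximalIdeal L ^ 2) := by
  intro hreg
  have hne : IsLocalRing.maximalIdeal L ^ 2 ≠ ⊤ := fun h => hv2 (h ▸ Submodule.mem_top)
  haveI : Nontrivial (L ⧸ IsLocalRing.maximalIdeal L ^ 2) := Ideal.Quotient.nontrivial_iff.mpr hne
  set S := L ⧸ IsLocalRing.maximalIdeal L ^ 2 with hS
  -- the class of `v` is a non-zero element of the maximal ideal of `S`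
  have hvne : Ideal.Quotient.mk (IsLocalRing.maximalIdeal L ^ 2) v ≠ 0 := by
    rwa [Ne, Ideal.Quotient.eq_zero_iff_mem]
  have hvmem : Ideal.Quotient.mk (IsLocalRing.maximalIdeal L ^ 2) v ∈ IsLocalRing.maximalIdeal S := by
    rw [IsLocalRing.mem_maximalIdeal, mem_nonunits_iff]
    intro hunit
    obtain ⟨w', hw'⟩ := hunit.exists_right_inv
    obtain ⟨w, rfl⟩ := Ideal.Quotient.mk_surjective w'
    rw [← map_mul, ← map_one (Ideal.Quotient.mk (IsLocalRing.maximalIdeal L ^ 2)),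
      Ideal.Quotient.eq] at hw'
    have h1 : v * w - (v * w - 1) ∈ IsLocalRing.maximalIdeal L :=
      Ideal.sub_mem _ (Ideal.mul_mem_right _ _ hv) (Ideal.pow_le_self two_ne_zero hw')
    rw [sub_sub_cancel] at h1
    exact (IsLocalRing.maximalIdeal.isMaximal L).ne_top (Ideal.eq_top_of_isUnit_mem _ h1 isUnit_one)
  -- every element of the maximal ideal of `S` squares to zero, so every prime is maximal
  have hsq : ∀ x ∈ IsLocalRing.maximalIdeal S, x ^ 2 = 0 := by
    intro x hx
    obtain ⟨y, rfl⟩ := Ideal.Quotient.mk_surjective x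
    have hy : y ∈ IsLocalRing.maximalIdeal L := by
      rw [IsLocalRing.mem_maximalIdeal, mem_nonunits_iff] at hx ⊢
      exact fun hu => hx (hu.map _)
    rw [← map_pow, Ideal.Quotient.eq_zero_iff_mem]
    exact Ideal.pow_mem_pow hy 2
  have hdim : Ring.KrullDimLE 0 S := by
    refine Ring.KrullDimLE.mk₀ fun P hP => ?_
    have hle : IsLocalRing.maximalIdeal S ≤ P := fun x hx =>
      hP.mem_of_pow_mem 2 (by rw [hsq x hx]; exact P.zero_mem)
    rw [← le_antisymm hle (IsLocalRing.le_maximalIdeal hP.ne_top)]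
    exact IsLocalRing.maximalIdeal.isMaximal S
  have hdim0 : ringKrullDim S = 0 := ringKrullDimZero_iff_ringKrullDim_eq_zero.mp hdim
  -- regularity would force the maximal ideal of `S` to be `⊥`
  have hspan := hreg.spanFinrank_maximalIdeal
  rw [hdim0] at hspan
  have h0 : (IsLocalRing.maximalIdeal S).spanFinrank = 0 := by exact_mod_cast hspan
  have hbot : IsLocalRing.maximalIdeal S = ⊥ :=
    (Submodule.spanFinrank_eq_zero_iff_eq_bot (IsNoetherian.noetherian _)).mp h0
  rw [hbot, Ideal.mem_bot] at hvmem
  exact hvne hvmem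

section FatPoint

variable (n : ℕ) (k : Type) [Field k]

/-- **Support of the fat point**: a point of `Spec k[x₁,…,xₙ]` lies in the support of the ideal sheaf
of `𝔪₀²` iff it is the origin. [OURS · folklore] -/
theorem mem_support_fatPoint_iff (y : Spec (.of (MvPolynomial (Fin n) k))) :
    y ∈ (Scheme.IdealSheafData.ofIdealTop
        (((RingHom.ker (MvPolynomial.constantCoeff : MvPolynomial (Fin n) k →+* k)) ^ 2).map
          (Scheme.ΓSpecIso (.of (MvPolynomial (Fin n) k))).inv.hom)).support ↔
      y = ⟨RingHom.ker (MvPolynomial.constantCoeff : MvPolynomial (Fin n) k →+* k),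
        RingHom.ker_isPrime _⟩ := by
  haveI h𝔪 : (RingHom.ker (MvPolynomial.constantCoeff : MvPolynomial (Fin n) k →+* k)).IsMaximal :=
    RingHom.ker_isMaximal_of_surjective _
      fun a => ⟨MvPolynomial.C a, MvPolynomial.constantCoeff_C _ a⟩
  rw [← SetLike.mem_coe, Scheme.IdealSheafData.coe_support_ofIdealTop, Ideal.map,
    Scheme.zeroLocus_span]
  change y ∈ (Spec (.of (MvPolynomial (Fin n) k))).zeroLocus
      ((Scheme.ΓSpecIso (.of (MvPolynomial (Fin n) k))).inv ''
        ((RingHom.ker (MvPolynomial.constantCoeff : MvPolynomial (Fin n) k →+* k) ^ 2 : Ideal _) :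
          Set (MvPolynomial (Fin n) k))) ↔ _
  rw [Spec_zeroLocus_eq_zeroLocus]
  change ((RingHom.ker (MvPolynomial.constantCoeff : MvPolynomial (Fin n) k →+* k) ^ 2 :
      Ideal (MvPolynomial (Fin n) k)) : Set (MvPolynomial (Fin n) k)) ⊆ y.asIdeal ↔ _
  rw [SetLike.coe_subset_coe, Ideal.IsPrime.pow_le_iff two_ne_zero]
  constructor
  · intro h
    exact PrimeSpectrum.ext (h𝔪.eq_of_le y.2.ne_top h).symm
  · rintro rfl
    exact le_rfl

variable {n k}

/-- **Singular locus of the fat point** (`1 ≤ n`): a point of `(Spec k[x₁,…,xₙ], 𝔪₀²)` is singular iff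
it is the origin. [OURS · folklore] -/
theorem xSing_fatPoint_iff (hn : 1 ≤ n) (y : Spec (.of (MvPolynomial (Fin n) k))) :
    XSing (Scheme.IdealSheafData.ofIdealTop
        (((RingHom.ker (MvPolynomial.constantCoeff : MvPolynomial (Fin n) k →+* k)) ^ 2).map
          (Scheme.ΓSpecIso (.of (MvPolynomial (Fin n) k))).inv.hom)) y ↔
      y = ⟨RingHom.ker (MvPolynomial.constantCoeff : MvPolynomial (Fin n) k →+* k),
        RingHom.ker_isPrime _⟩ := by
  set A := MvPolynomial (Fin n) k with hA
  haveI h𝔪 : (RingHom.ker (MvPolynomial.constantCoeff : MvPolynomial (Fin n) k →+* k)).IsPrime :=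
    RingHom.ker_isPrime _
  set 𝔪 : Ideal A := RingHom.ker (MvPolynomial.constantCoeff : MvPolynomial (Fin n) k →+* k)
    with h𝔪def
  set X : (Spec (.of A)).IdealSheafData :=
    Scheme.IdealSheafData.ofIdealTop ((𝔪 ^ 2).map (Scheme.ΓSpecIso (.of A)).inv.hom) with hX
  set y₀ : Spec (.of A) := ⟨𝔪, h𝔪⟩ with hy₀
  constructor
  · rintro ⟨x, hx, -⟩
    have hmem : y ∈ (X.support : Set (Spec (.of A))) := by
      rw [← Scheme.IdealSheafData.range_subschemeι]
      exact ⟨x, hx⟩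
    exact (mem_support_fatPoint_iff n k y).mp hmem
  · rintro rfl
    -- a point of the subscheme over the origin
    have hmem : y₀ ∈ (X.support : Set (Spec (.of A))) := (mem_support_fatPoint_iff n k _).mpr rfl
    rw [← Scheme.IdealSheafData.range_subschemeι] at hmem
    obtain ⟨x, hx⟩ := hmem
    refine ⟨x, hx, ?_⟩
    -- its local ring is `𝒪_{Y,0} / 𝔪₀² 𝒪_{Y,0}`
    rw [isRegularLocalRing_stalk_subscheme_iff X x]
    rw [hx]
    letI : Algebra A ((Spec (.of A)).presheaf.stalk y₀) := StructureSheaf.stalkAlgebra A y₀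
    haveI : IsLocalization.AtPrime ((Spec (.of A)).presheaf.stalk y₀) y₀.asIdeal :=
      StructureSheaf.IsLocalization.to_stalk A y₀
    have hstalk : stalkIdeal X y₀ = IsLocalRing.maximalIdeal ((Spec (.of A)).presheaf.stalk y₀) ^ 2 := by
      rw [stalkIdeal_eq_map_germ X ⟨⊤, isAffineOpen_top _⟩ (Set.mem_univ _), hX,
        map_germ_ofIdealTop_ideal, Ideal.map_map]
      change (𝔪 ^ 2).map (algebraMap A ((Spec (.of A)).presheaf.stalk y₀)) = _
      rw [Ideal.map_pow, IsLocalization.AtPrime.map_eq_maximalIdeal 𝔪]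
    rw [hstalk]
    -- `x₀ ∈ 𝔪 𝒪_{Y,0} ∖ (𝔪 𝒪_{Y,0})²` by cotangent independence of the coordinates
    have hXmem : ∀ i, algebraMap A ((Spec (.of A)).presheaf.stalk y₀) (MvPolynomial.X i) ∈
        IsLocalRing.maximalIdeal _ :=
      fun i => (IsLocalization.AtPrime.to_map_mem_maximal_iff _ 𝔪 (MvPolynomial.X i)).mpr
        (RingHom.mem_ker.mpr (MvPolynomial.constantCoeff_X (R := k) i))
    have hli := linearIndependent_toCotangent_X (n := n) (k := k)
      (L := (Spec (.of A)).presheaf.stalk y₀) hXmem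
    have hne := hli.ne_zero ⟨0, hn⟩
    rw [Ne, Ideal.toCotangent_eq_zero] at hne
    exact not_isRegularLocalRing_quotient_maximalIdeal_sq (hXmem ⟨0, hn⟩) hne

end FatPoint

end Summit.ResolutionOfSingularities.ResolutionOfSingularities.Theorems.PointwiseLexmaxHull

end
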